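import Literature.AlgebraicGeometry.Resolution.RegularParameterFamilies
import Literature.AlgebraicGeometry.Resolution.KummerNormalForm
import Mathlib.RingTheory.Ideal.Quotient.Operations
import HarnessLib

/-!
# Quotients of a regular local ring by a family of regular parameters

Topic: `Literature/AlgebraicGeometry/Resolution`. Sequel to `RegularParameterFamilies.lean`. For
a regular local ring `(O, 𝔪)` and a family `x : Fin r → O` of elements of `𝔪` independent
modulo `𝔪²` (`∑ α_i x_i ∈ 𝔪² ⇒ α_i ∈ 𝔪`, i.e. part of a regular system of parameters):

* `hli_quotient_tail` — independence passes to the images of `x_1, …, x_{r-1}` in `O/(x_0)`;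
* `isRegularLocalRing_quotient_span_range` — **Matsumura Thm. 14.2 (2) ⇒ (3)**:
  `O/(x_0, …, x_{r-1})` is a regular local ring of dimension `dim O - r` (induction on `r`,
  one parameter at a time, `IsRegularLocalRing.quotient_span_singleton`);
* `isWoundOrTransversalAt_quotient` — the wound-or-transversal condition on a unit `u`
  relative to the boundary `x` (`IsWoundOrTransversalAt`, `KummerNormalForm.lean`) descends to
  the plain (boundary-free) wound-or-transversal condition on `ū ∈ O/(x)`: this is how the
  regularity of the wound twist `O[T]/(T^p - u)` modulo the boundary equations reduces to the
  wound/transversal exits over the regular local ring `O/(x)`.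

Sources: [Matsumura1987] H. Matsumura, *Commutative Ring Theory*, CUP (1987), Thm. 14.2.
All statements PROVED.
-/

noncomputable section

namespace Literature.AlgebraicGeometry.Resolution

open IsLocalRing

namespace RegularParameters

variable {O : Type*} [CommRing O]

/-- The sum `∑_{i : Fin (r+1)} β_i x_i` splits as `β_0 x_0 + ∑_i β_{i+1} x_{i+1}`. [folklore] -/
theorem sum_mul_succ {r : ℕ} (β : Fin (r + 1) → O) (x : Fin (r + 1) → O) :
    ∑ i, β i * x i = β 0 * x 0 + ∑ i : Fin r, β i.succ * x i.succ :=
  Fin.sum_univ_succ _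

section Local

variable [IsLocalRing O]

/-- **Independence modulo `𝔪²` passes to the quotient by the first parameter**: for the images
`x̄_{i+1}` of the remaining parameters in `O/(x_0)`. [cite: Matsumura1987, Thm. 14.2] -/
theorem hli_quotient_tail {r : ℕ} {x : Fin (r + 1) → O}
    (hli : ∀ α : Fin (r + 1) → O, ∑ i, α i * x i ∈ maximalIdeal O ^ 2 →
      ∀ i, α i ∈ maximalIdeal O)
    [Nontrivial (O ⧸ Ideal.span {x 0})] :
    letI := IsLocalRing.of_surjective' (Ideal.Quotient.mk (Ideal.span {x 0}))
      Ideal.Quotient.mk_surjective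
    ∀ α : Fin r → O ⧸ Ideal.span {x 0},
      ∑ i, α i * Ideal.Quotient.mk (Ideal.span {x 0}) (x i.succ) ∈
        maximalIdeal (O ⧸ Ideal.span {x 0}) ^ 2 →
      ∀ i, α i ∈ maximalIdeal (O ⧸ Ideal.span {x 0}) := by
  letI := IsLocalRing.of_surjective' (Ideal.Quotient.mk (Ideal.span {x 0}))
    Ideal.Quotient.mk_surjective
  intro α hα i
  have hmax : maximalIdeal (O ⧸ Ideal.span {x 0}) =
      (maximalIdeal O).map (Ideal.Quotient.mk _) := maximalIdeal_quotient_eq_map _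
  -- lift the coefficients
  choose α' hα' using fun i => Ideal.Quotient.mk_surjective (α i)
  have hsum : ∑ i, α i * Ideal.Quotient.mk (Ideal.span {x 0}) (x i.succ) =
      Ideal.Quotient.mk (Ideal.span {x 0}) (∑ i, α' i * x i.succ) := by
    rw [map_sum]
    refine Finset.sum_congr rfl fun i _ => ?_
    rw [map_mul, hα']
  rw [hsum, hmax, ← Ideal.map_pow, Ideal.mem_quotient_iff_mem_sup] at hα
  obtain ⟨m, hm, y, hy, hmy⟩ := Submodule.mem_sup.mp hα
  obtain ⟨b, rfl⟩ := Ideal.mem_span_singleton'.mp hy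
  -- the combination `-b x_0 + ∑ α'_i x_{i+1}` lies in `𝔪²`
  let β : Fin (r + 1) → O := Fin.cons (-b) α'
  have hβ : ∑ k, β k * x k ∈ maximalIdeal O ^ 2 := by
    rw [sum_mul_succ]
    simp only [β, Fin.cons_zero, Fin.cons_succ]
    have : -b * x 0 + ∑ i : Fin r, α' i * x i.succ = m := by rw [← hmy]; ring
    rw [this]
    exact hm
  have := hli β hβ i.succ
  simp only [β, Fin.cons_succ] at this
  rw [← hα', hmax]
  exact Ideal.mem_map_of_mem _ this

end Local

section Regular

variable [IsRegularLocalRing O]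

/-- **Matsumura Thm. 14.2, (2) ⇒ (3)**: the quotient of a regular local ring by a family of
`r` regular parameters (elements of `𝔪` independent modulo `𝔪²`) is a regular local ring of
dimension `dim O - r`. [cite: Matsumura1987, Thm. 14.2] -/
theorem isRegularLocalRing_quotient_span_range :
    ∀ {r : ℕ} (x : Fin r → O), (∀ j, x j ∈ maximalIdeal O) →
      (∀ α : Fin r → O, ∑ i, α i * x i ∈ maximalIdeal O ^ 2 → ∀ i, α i ∈ maximalIdeal O) →
      IsRegularLocalRing (O ⧸ Ideal.span (Set.range x)) ∧
        ringKrullDim (O ⧸ Ideal.span (Set.range x)) + r = ringKrullDim O := by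
  intro r
  induction r generalizing O with
  | zero =>
    intro x _ _
    have hbot : Ideal.span (Set.range x) = ⊥ := by
      rw [Ideal.span_eq_bot]
      rintro _ ⟨i, rfl⟩
      exact i.elim0
    let e : (O ⧸ Ideal.span (Set.range x)) ≃+* O :=
      (Ideal.quotEquivOfEq hbot).trans (RingEquiv.quotientBot O)
    exact ⟨IsRegularLocalRing.of_ringEquiv e.symm, by
      rw [Nat.cast_zero, add_zero, ringKrullDim_eq_of_ringEquiv e]⟩
  | succ r ih =>
    intro x hx hli
    -- quotient by the first parameter
    obtain ⟨hreg₁, hdim₁⟩ :=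
      IsRegularLocalRing.quotient_span_singleton (hx 0) (notMem_sq hli 0)
    haveI := hreg₁
    haveI : Nontrivial (O ⧸ Ideal.span {x 0}) := inferInstance
    let x' : Fin r → O ⧸ Ideal.span {x 0} := fun i => Ideal.Quotient.mk _ (x i.succ)
    have hmax : maximalIdeal (O ⧸ Ideal.span {x 0}) =
        (maximalIdeal O).map (Ideal.Quotient.mk _) := maximalIdeal_quotient_eq_map _
    have hx' : ∀ j, x' j ∈ maximalIdeal (O ⧸ Ideal.span {x 0}) := fun j => by
      rw [hmax]; exact Ideal.mem_map_of_mem _ (hx j.succ)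
    obtain ⟨hreg, hdim⟩ := ih x' hx' (hli_quotient_tail hli)
    -- `(O/(x_0))/(x̄_1, …) ≅ O/(x_0, x_1, …)`
    have hJ : Ideal.span (Set.range x') =
        (Ideal.span (Set.range (Fin.tail x))).map (Ideal.Quotient.mk (Ideal.span {x 0})) := by
      rw [Ideal.map_span, ← Set.range_comp]
      rfl
    have hsup : Ideal.span {x 0} ⊔ Ideal.span (Set.range (Fin.tail x)) =
        Ideal.span (Set.range x) := by
      rw [← Ideal.span_union, Set.singleton_union, ← Fin.range_fin_succ]
    let e : ((O ⧸ Ideal.span {x 0}) ⧸ Ideal.span (Set.range x')) ≃+*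
        O ⧸ Ideal.span (Set.range x) :=
      (Ideal.quotEquivOfEq hJ).trans
        ((DoubleQuot.quotQuotEquivQuotSup _ _).trans (Ideal.quotEquivOfEq hsup))
    refine ⟨IsRegularLocalRing.of_ringEquiv e, ?_⟩
    rw [← ringKrullDim_eq_of_ringEquiv e, ← hdim₁, ← hdim, Nat.cast_succ, add_assoc]

/-- The maximal ideal of `O/(x)` is the image of `𝔪`, and `mk (u - c^p) ∈ 𝔪̄ⁿ ↔
u - c^p ∈ 𝔪ⁿ + (x)`. [folklore] -/
theorem mk_mem_maximalIdeal_pow_iff {r : ℕ} (x : Fin r → O) (hx : ∀ j, x j ∈ maximalIdeal O)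
    [Nontrivial (O ⧸ Ideal.span (Set.range x))] (n : ℕ) (y : O) :
    letI := IsLocalRing.of_surjective' (Ideal.Quotient.mk (Ideal.span (Set.range x)))
      Ideal.Quotient.mk_surjective
    Ideal.Quotient.mk (Ideal.span (Set.range x)) y ∈
        maximalIdeal (O ⧸ Ideal.span (Set.range x)) ^ n ↔
      y ∈ maximalIdeal O ^ n ⊔ Ideal.span (Set.range x) := by
  letI := IsLocalRing.of_surjective' (Ideal.Quotient.mk (Ideal.span (Set.range x)))
    Ideal.Quotient.mk_surjective
  have _ := hx
  rw [maximalIdeal_quotient_eq_map, ← Ideal.map_pow, Ideal.mem_quotient_iff_mem_sup]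

omit [IsRegularLocalRing O] in
/-- **The wound-or-transversal condition descends modulo the boundary**: if `u` is
wound-or-transversal relative to `x` in the local ring `O` (`IsWoundOrTransversalAt p x u`) and
the `x_j` lie in `𝔪`, then the image of `u` in `O/(x)` is wound-or-transversal relative to the
empty boundary. [folklore] -/
theorem isWoundOrTransversalAt_quotient [IsLocalRing O] {p : ℕ} {r : ℕ} {x : Fin r → O}
    (hx : ∀ j, x j ∈ maximalIdeal O) {u : O} (hu : IsWoundOrTransversalAt p x u)
    [Nontrivial (O ⧸ Ideal.span (Set.range x))] :
    letI := IsLocalRing.of_surjective' (Ideal.Quotient.mk (Ideal.span (Set.range x)))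
      Ideal.Quotient.mk_surjective
    IsWoundOrTransversalAt p (Fin.elim0 : Fin 0 → O ⧸ Ideal.span (Set.range x))
      (Ideal.Quotient.mk (Ideal.span (Set.range x)) u) := by
  letI := IsLocalRing.of_surjective' (Ideal.Quotient.mk (Ideal.span (Set.range x)))
    Ideal.Quotient.mk_surjective
  have hI : Ideal.span (Set.range x) ≤ maximalIdeal O :=
    Ideal.span_le.mpr (by rintro _ ⟨j, rfl⟩; exact hx j)
  have hmax : maximalIdeal (O ⧸ Ideal.span (Set.range x)) =
      (maximalIdeal O).map (Ideal.Quotient.mk _) := maximalIdeal_quotient_eq_map _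
  have hempty : Ideal.span (Set.range (Fin.elim0 : Fin 0 → O ⧸ Ideal.span (Set.range x))) = ⊥ := by
    rw [Ideal.span_eq_bot]; rintro _ ⟨i, rfl⟩; exact i.elim0
  rcases hu with hw | ⟨c, hc, hc2⟩
  · left
    intro cq hmem
    obtain ⟨c, rfl⟩ := Ideal.Quotient.mk_surjective cq
    rw [← map_pow, ← map_sub, hmax, Ideal.mem_quotient_iff_mem_sup, sup_eq_left.mpr hI] at hmem
    exact hw c hmem
  · right
    refine ⟨Ideal.Quotient.mk _ c, ?_, ?_⟩
    · rw [← map_pow, ← map_sub, hmax]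
      exact Ideal.mem_map_of_mem _ hc
    · rw [hempty, sup_bot_eq, ← map_pow, ← map_sub, hmax, ← Ideal.map_pow,
        Ideal.mem_quotient_iff_mem_sup]
      exact hc2

end Regular

end RegularParameters

end Literature.AlgebraicGeometry.Resolution

end
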